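import Summits.ResolutionOfSingularities.ResolutionOfSingularities.Theorems.HilbertSamuelEliminationSigmaMaxModificationsCorridor3SigmaMenuScheduler
import Summits.ResolutionOfSingularities.ResolutionOfSingularities.Theorems.HilbertSamuelEliminationSigmaMaxModificationsCorridor3SigmaBirthDictionary3
import Literature.AlgebraicGeometry.Resolution.BlowupOffCentre
import HarnessLib

/-!
# [OURS · L1 W4.2] σ-LAYER — `Corridor3SigmaMenuSchedulerFair` (file 2/2 of the π₀ = OLDEST-SITE-FIRST design): the ABSTRACT FAIRNESS THEOREM
# «oldest-first starves no live site» and the boundary AGE key `boundaryKey` with its transport laws (T0)/(T2-age)/(T3)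
# (res-L1-w42-plan-1 RULING v3.14-18 (FI) / WORD 12:33:52Z GO; crux chain w42 `SigmaMaxModifications` stmt-ResolutionOfSingularities-18506 / conjunct
# `SigmaMaxModificationsCorridor3` stmt-ResolutionOfSingularities-19249; typer res-L1-type-o1 (OURS typer G4); `--supports stmt-…-19249 --as helper`, counted 0)

HONEST FRAMING. OURS proof bookkeeping over file 1/2 `…Corridor3SigmaMenuScheduler` (`SiteProposal`, `SiteKey`, `IsLiveSite`, `StrategyE.oldestFirst`,
`NoWaitingChainWithinFromσE`, …) and this typer's σ-layer. NOTHING here is a statement of H. Hironaka's manuscript [Hironaka2017] nor of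
Cossart–Jannsen–Saito [CossartJannsenSaito2020]; no named fact is introduced; AI-typed, AI review is weaker than expert review.

## Why oldest-first is fair (§3, proved, scheme-free counting)

While a live site of age `k` waits, EVERY step serves a site of age `≤ k` (minimality); no site of age `≤ k` is born (newborn sites carry the new
exceptional member, whose age exceeds the boundary length, which bounds `k`); unserved sites do not split (the blow-up is injective off the centre,
067's `injOn_compl_preimage_support`). Hence `#{live sites of age ≤ k}` drops by at least one per step while it stays `≥ 1` — impossible for ever:
**`noWaitingChainWithin_live_oldestFirst_hybrid`**. Its hypotheses — (T0) ages `≤ |E|`, (T1) finitely many live sites per reachable stage, (T2) a live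
site OFF the exceptional divisor lies over a live site of the SAME age, (T3) a live site ON the exceptional divisor has age `> |E|`, (T4) proposals pass
through their site — are the successor rows of the INSTANCES (corner oracle / isolated points); for the boundary age of §4, (T0) and (T3) hold for
every point and the age half of (T2) is `boundaryKey_next_of_not_mem` (all proved here); (T4) holds for every menu-valued proposal
(`support_of_plusMenu_proposal`, file 1/2); (T1) suppliers: 067's `InScopeMσE.fullCornerLocus_finite` (corners), `setOf_singleton_mem_componentsIn_finite`
(isolated points, §4).

HONEST LIMIT (RULINGS v3.14-5 (BM)(3); WORD 12:33:52Z (ii)): this is FAIRNESS for the AGE instance only — necessary, NOT sufficient for termination; the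
invariant-first instance of the combinator needs no fairness theorem (its termination is descent); the Top third `HybridTopHyp3` is NOT claimed.

VACUITY SELF-CHECK. The theorem is not vacuous: its antecedent is met by the isolated-point proposal with the boundary age, and its conclusion FAILS
for other selection rules (NEWEST-first starves the first-born site whenever births never stop) — the content is the counting argument.

## Contents (namespace `…Theorems.SigmaMaxModificationsCorridor3.Sigma`)

* §3 `oldestFirst_one_step` (the one-step count) and **`noWaitingChainWithin_live_oldestFirst_hybrid`**.
* §4 `lastKeyRev`, **`boundaryKey : SiteKey ℕ`**, `boundaryKey_le_length` (T0), `boundaryKey_next_of_mem` (T3),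
  `mem_support_strictTransformIdeal_iff_of_not_mem`, `boundaryKey_next_of_not_mem` (age half of (T2)), `setOf_singleton_mem_componentsIn_finite` ((T1),
  isolated points); and, over res-type-067's `…SigmaBirthDictionary3` (p531944): `oldThrough_eq_membersThrough_of_not_mem`,
  `cornerSize_next_eq_of_not_mem`, `isFullCorner_next_iff_of_not_mem` (off the exceptional divisor the boundary corner is UNCHANGED — the corner half
  of (T2) for a full-corner proposal relation).
-/

noncomputable section

set_option linter.dupNamespace false -- mandated namespace of this single-conjunct summit

open CategoryTheory AlgebraicGeometry TopologicalSpace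
open Summit.ResolutionOfSingularities.ResolutionOfSingularities.Theorems.CampaignW42
open Literature.AlgebraicGeometry.Resolution Literature.RingTheory.HilbertSamuel

namespace Summit.ResolutionOfSingularities.ResolutionOfSingularities.Theorems.SigmaMaxModificationsCorridor3.Sigma

universe u

/-! ## §3. The abstract fairness theorem: OLDEST-SITE-FIRST starves no live site -/

section Fairness

variable {ρ : SiteProposal.{u}} {κ : SiteKey.{u} ℕ} {τ : StrategyE.{u}} {N : ℕ} {ν : ℕ → ℕ}

/-- **THE ONE-STEP COUNT.** Along one step of the hybrid `π₀.hybrid τ` from a stage `s` whose marked point is a LIVE site that is NOT blown up, to a stage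
`s'` whose marked point is live: under (T1) finitely many live sites at `s`, (T2) live sites of `s'` off the exceptional divisor lie over live sites of
`s` of the same age, (T3) live sites of `s'` on the exceptional divisor have age `> |E(s)|`, (T4) proposals pass through their site — for every `k` with
`age(s.pt) ≤ k ≤ |E(s)|`: the age of the marked point is unchanged, the boundary grows, and `#{live sites of s' of age ≤ k} + 1 ≤ #{live sites of s of
age ≤ k}`. [folklore] -/
theorem oldestFirst_one_step {s s' : MarkedStageE.{u}}
    (hss' : CanonicalNearStepσE ((StrategyE.oldestFirst ρ κ).hybrid τ) N ν s s')
    (hT4 : ∀ (W : Scheme.{u}) (hW : IsLocallyNoetherian W) (L : Labelling W) (P : Option (Pending W)) (E : Boundary W) (x : W)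
      (C : W.IdealSheafData) (P' : Option (Pending (blowup C))), ρ W hW N ν L P E x C P' → x ∈ (C.support : Set W))
    (hT1 : {y : s.W | IsLiveSite ρ s.W s.ln N ν s.L s.P s.E y}.Finite)
    (hT23 : ∀ (C : s.W.IdealSheafData) (P' : Option (Pending (blowup C))) (h : IsLocallyNoetherian (blowup C)),
      (StrategyE.oldestFirst ρ κ).step s.W s.ln N ν s.L s.P s.E C P' →
      ∀ y' : ↥(blowup C), IsLiveSite ρ (blowup C) h N ν (s.L.next (Scheme.hsStratum s.W N ν) C) P' (s.E.next C) y' →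
        ((blowup.π C).base y' ∉ (C.support : Set s.W) →
          IsLiveSite ρ s.W s.ln N ν s.L s.P s.E ((blowup.π C).base y') ∧
            κ (blowup C) h N ν (s.L.next (Scheme.hsStratum s.W N ν) C) P' (s.E.next C) y' = κ s.W s.ln N ν s.L s.P s.E ((blowup.π C).base y')) ∧
        ((blowup.π C).base y' ∈ (C.support : Set s.W) →
          s.E.length < κ (blowup C) h N ν (s.L.next (Scheme.hsStratum s.W N ν) C) P' (s.E.next C) y'))
    (hlive : s.IsLiveSite ρ N ν) (hlive' : s'.IsLiveSite ρ N ν) (hwait : ¬ s.IsBlownUpσE ((StrategyE.oldestFirst ρ κ).hybrid τ) N ν)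
    {k : ℕ} (hks : κ s.W s.ln N ν s.L s.P s.E s.pt ≤ k) (hk : k ≤ s.E.length) :
    κ s'.W s'.ln N ν s'.L s'.P s'.E s'.pt = κ s.W s.ln N ν s.L s.P s.E s.pt ∧ s.E.length ≤ s'.E.length ∧
      {y' : s'.W | IsLiveSite ρ s'.W s'.ln N ν s'.L s'.P s'.E y' ∧ κ s'.W s'.ln N ν s'.L s'.P s'.E y' ≤ k}.ncard + 1 ≤
        {y : s.W | IsLiveSite ρ s.W s.ln N ν s.L s.P s.E y ∧ κ s.W s.ln N ν s.L s.P s.E y ≤ k}.ncard := by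
  obtain ⟨C, P', hbl, x', hσ, hπ, -, -, rfl⟩ := hss'
  -- the step is a policy step (the marked point is live, so the policy speaks)
  have hpol : (StrategyE.oldestFirst ρ κ).step s.W s.ln N ν s.L s.P s.E C P' :=
    StrategyE.hybrid_oldestFirst_step_of_hasOldestLiveSite (HasLiveSite.hasOldestLiveSite ⟨s.pt, hlive⟩) hσ
  obtain ⟨z, ⟨hzlive, hzmin⟩, hzρ⟩ := StrategyE.oldestFirst_step_spec hpol
  have hzC : z ∈ (C.support : Set s.W) := hT4 _ _ _ _ _ z C P' hzρ
  -- the marked point is not blown up: it lies off the centre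
  have hptC : s.pt ∉ (C.support : Set s.W) := fun h => hwait ⟨C, P', hσ, h⟩
  have hdesc := hT23 C P' hbl hpol
  -- (a) the age of the marked point is unchanged
  have hx'C : (blowup.π C).base x' ∉ (C.support : Set s.W) := by rwa [hπ]
  have hkey' := ((hdesc x' hlive').1 hx'C).2
  refine ⟨by simpa [hπ] using hkey', ?_, ?_⟩
  · show s.E.length ≤ (s.E.next C).length
    simp
  -- (c) the count: blow down the live sites of age ≤ k of s' into those of s minus the served site z
  set S' : Set ↥(blowup C) := {y' | IsLiveSite ρ (blowup C) hbl N ν (s.L.next (Scheme.hsStratum s.W N ν) C) P' (s.E.next C) y' ∧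
    κ (blowup C) hbl N ν (s.L.next (Scheme.hsStratum s.W N ν) C) P' (s.E.next C) y' ≤ k} with hS'
  set S : Set s.W := {y | IsLiveSite ρ s.W s.ln N ν s.L s.P s.E y ∧ κ s.W s.ln N ν s.L s.P s.E y ≤ k} with hS
  have hSfin : S.Finite := hT1.subset fun y hy => hy.1
  have hzS : z ∈ S := ⟨hzlive, (hzmin s.pt hlive).trans hks⟩
  -- every member of S' lies off the exceptional divisor (newborn sites are too young)
  have hoff : ∀ y' ∈ S', (blowup.π C).base y' ∉ (C.support : Set s.W) := by
    intro y' hy' hmem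
    have := (hdesc y' hy'.1).2 hmem
    have := hy'.2
    omega
  have hmaps : ∀ y' ∈ S', (blowup.π C).base y' ∈ S \ {z} := by
    intro y' hy'
    obtain ⟨hl, hκ⟩ := (hdesc y' hy'.1).1 (hoff y' hy')
    refine ⟨⟨hl, ?_⟩, fun h => hoff y' hy' ?_⟩
    · rw [← hκ]; exact hy'.2
    · rw [Set.mem_singleton_iff] at h
      rw [h]; exact hzC
  have hinj : Set.InjOn (blowup.π C).base S' :=
    (injOn_compl_preimage_support C).mono fun y' hy' => hoff y' hy'
  have hle : S'.ncard ≤ (S \ {z}).ncard := Set.ncard_le_ncard_of_injOn _ hmaps hinj (hSfin.subset Set.sdiff_subset)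
  rw [Set.ncard_sdiff_singleton_of_mem hzS] at hle
  have hpos : 0 < S.ncard := (Set.ncard_pos hSfin).mpr ⟨z, hzS⟩
  change S'.ncard + 1 ≤ S.ncard
  omega

/-- **THE ABSTRACT FAIRNESS THEOREM — OLDEST-SITE-FIRST STARVES NO LIVE SITE.** For the hybrid `σ = π₀.hybrid τ` of `π₀ = StrategyE.oldestFirst ρ κ` over
ANY fallback `τ`, from any `s₀`: if (T4) proposals pass through their site, and at every stage `s` that `σ` reaches from `s₀` (T0) live sites have age
`≤ |E(s)|`, (T1) the live sites are finite, and along every π₀-step `(C, P')` from `s` (T2) a live site of the next state OFF the exceptional divisor lies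
over a live site of `s` of the SAME age and (T3) a live site ON the exceptional divisor has age `> |E(s)|` — then there is NO infinite σ-chain from `s₀`
whose marked point is a live site at every stage and is never blown up: `NoWaitingChainWithinFromσE σ N ν s₀ (MarkedStageE.IsLiveSite ρ N ν)`.
Scheme-free counting (§ module docstring); the instances owe (T0)–(T3). [folklore] -/
theorem noWaitingChainWithin_live_oldestFirst_hybrid (s₀ : MarkedStageE.{u})
    (hT4 : ∀ (W : Scheme.{u}) (hW : IsLocallyNoetherian W) (L : Labelling W) (P : Option (Pending W)) (E : Boundary W) (x : W)
      (C : W.IdealSheafData) (P' : Option (Pending (blowup C))), ρ W hW N ν L P E x C P' → x ∈ (C.support : Set W))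
    (hT0 : ∀ s : MarkedStageE.{u}, ReachesσE ((StrategyE.oldestFirst ρ κ).hybrid τ) N ν s₀ s →
      ∀ y : s.W, IsLiveSite ρ s.W s.ln N ν s.L s.P s.E y → κ s.W s.ln N ν s.L s.P s.E y ≤ s.E.length)
    (hT1 : ∀ s : MarkedStageE.{u}, ReachesσE ((StrategyE.oldestFirst ρ κ).hybrid τ) N ν s₀ s →
      {y : s.W | IsLiveSite ρ s.W s.ln N ν s.L s.P s.E y}.Finite)
    (hT23 : ∀ s : MarkedStageE.{u}, ReachesσE ((StrategyE.oldestFirst ρ κ).hybrid τ) N ν s₀ s →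
      ∀ (C : s.W.IdealSheafData) (P' : Option (Pending (blowup C))) (h : IsLocallyNoetherian (blowup C)),
      (StrategyE.oldestFirst ρ κ).step s.W s.ln N ν s.L s.P s.E C P' →
      ∀ y' : ↥(blowup C), IsLiveSite ρ (blowup C) h N ν (s.L.next (Scheme.hsStratum s.W N ν) C) P' (s.E.next C) y' →
        ((blowup.π C).base y' ∉ (C.support : Set s.W) →
          IsLiveSite ρ s.W s.ln N ν s.L s.P s.E ((blowup.π C).base y') ∧
            κ (blowup C) h N ν (s.L.next (Scheme.hsStratum s.W N ν) C) P' (s.E.next C) y' = κ s.W s.ln N ν s.L s.P s.E ((blowup.π C).base y')) ∧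
        ((blowup.π C).base y' ∈ (C.support : Set s.W) →
          s.E.length < κ (blowup C) h N ν (s.L.next (Scheme.hsStratum s.W N ν) C) P' (s.E.next C) y')) :
    NoWaitingChainWithinFromσE ((StrategyE.oldestFirst ρ κ).hybrid τ) N ν s₀ (MarkedStageE.IsLiveSite ρ N ν) := by
  rintro ⟨c, h0, hstep, hlive, hwait⟩
  have hreach : ∀ n, ReachesσE ((StrategyE.oldestFirst ρ κ).hybrid τ) N ν s₀ (c n) := fun n => by
    induction n with
    | zero => exact h0
    | succ n ih => exact ih.tail (hstep n)
  -- the age `k` of the waiting point is constant, and stays below the boundary length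
  set k : ℕ := κ (c 0).W (c 0).ln N ν (c 0).L (c 0).P (c 0).E (c 0).pt with hk
  have hinv : ∀ n, κ (c n).W (c n).ln N ν (c n).L (c n).P (c n).E (c n).pt = k ∧ k ≤ (c n).E.length := fun n => by
    induction n with
    | zero => exact ⟨rfl, hT0 _ h0 _ (hlive 0)⟩
    | succ n ih =>
      obtain ⟨hκ, hlen, -⟩ := oldestFirst_one_step (hstep n) hT4 (hT1 _ (hreach n)) (hT23 _ (hreach n)) (hlive n) (hlive (n + 1))
        (hwait n) ih.1.le ih.2
      exact ⟨hκ.trans ih.1, ih.2.trans hlen⟩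
  -- the count of live sites of age ≤ k drops at every step
  set a : ℕ → ℕ := fun n =>
    {y : (c n).W | IsLiveSite ρ (c n).W (c n).ln N ν (c n).L (c n).P (c n).E y ∧ κ (c n).W (c n).ln N ν (c n).L (c n).P (c n).E y ≤ k}.ncard
    with ha
  have hdrop : ∀ n, a (n + 1) + 1 ≤ a n := fun n =>
    (oldestFirst_one_step (hstep n) hT4 (hT1 _ (hreach n)) (hT23 _ (hreach n)) (hlive n) (hlive (n + 1)) (hwait n)
      (hinv n).1.le (hinv n).2).2.2
  have hsum : ∀ n, a n + n ≤ a 0 := fun n => by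
    induction n with
    | zero => simp
    | succ n ih => have := hdrop n; omega
  have := hsum (a 0 + 1)
  omega

end Fairness

/-! ## §4. The boundary AGE key and its transport laws -/

section Key

variable {W : Scheme.{u}}

open scoped Classical in
/-- [OURS · L1 W4.2] Auxiliary: on a REVERSED boundary list, one more than the position-from-the-end of the first member through `x` (`0` if none). [folklore] -/
def lastKeyRev (x : W) : List W.IdealSheafData → ℕ
  | [] => 0
  | I :: l => if x ∈ (I.support : Set W) then l.length + 1 else lastKeyRev x l

/-- Unfolding at a member through `x`. [folklore] -/
theorem lastKeyRev_cons_of_mem {x : W} {I : W.IdealSheafData} (h : x ∈ (I.support : Set W)) (l : List W.IdealSheafData) :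
    lastKeyRev x (I :: l) = l.length + 1 := by
  classical
  simp [lastKeyRev, h]

/-- Unfolding at a member missing `x`. [folklore] -/
theorem lastKeyRev_cons_of_not_mem {x : W} {I : W.IdealSheafData} (h : x ∉ (I.support : Set W)) (l : List W.IdealSheafData) :
    lastKeyRev x (I :: l) = lastKeyRev x l := by
  classical
  simp [lastKeyRev, h]

/-- The auxiliary key is at most the length. [folklore] -/
theorem lastKeyRev_le_length (x : W) : ∀ l : List W.IdealSheafData, lastKeyRev x l ≤ l.length
  | [] => le_rfl
  | I :: l => by
    by_cases h : x ∈ (I.support : Set W)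
    · simp [lastKeyRev_cons_of_mem h]
    · exact (lastKeyRev_cons_of_not_mem h l).trans_le ((lastKeyRev_le_length x l).trans (by simp))

/-- Transport of the auxiliary key along a member-wise map respecting «passes through». [folklore] -/
theorem lastKeyRev_map {W' : Scheme.{u}} (g : W.IdealSheafData → W'.IdealSheafData) {x' : W'} {x : W} :
    ∀ l : List W.IdealSheafData, (∀ I ∈ l, (x' ∈ ((g I).support : Set W') ↔ x ∈ (I.support : Set W))) →
      lastKeyRev x' (l.map g) = lastKeyRev x l
  | [], _ => rfl
  | I :: l, h => by
    have hI := h I (by simp)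
    have hl : ∀ J ∈ l, (x' ∈ ((g J).support : Set W') ↔ x ∈ (J.support : Set W)) := fun J hJ => h J (by simp [hJ])
    by_cases hx : x ∈ (I.support : Set W)
    · rw [List.map_cons, lastKeyRev_cons_of_mem (hI.mpr hx), lastKeyRev_cons_of_mem hx, List.length_map]
    · rw [List.map_cons, lastKeyRev_cons_of_not_mem (fun h' => hx (hI.mp h')), lastKeyRev_cons_of_not_mem hx, lastKeyRev_map g l hl]

/-- [OURS · L1 W4.2] **THE BOUNDARY AGE KEY**: `boundaryKey … E x` = one more than the index in `E` of the YOUNGEST boundary member through `x` (`0` if no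
member passes through `x`) — the year, on the boundary clock, after which the corner / point `x` was born. Instance of `SiteKey` for corners AND
isolated points alike. NOT a statement of the manuscript. [folklore] -/
def boundaryKey : SiteKey.{u} ℕ :=
  fun _ _ _ _ _ _ E x => lastKeyRev x E.reverse

/-- Unfolding. [folklore] -/
theorem boundaryKey_eq (hW : IsLocallyNoetherian W) (N : ℕ) (ν : ℕ → ℕ) (L : Labelling W) (P : Option (Pending W)) (E : Boundary W) (x : W) :
    boundaryKey W hW N ν L P E x = lastKeyRev x E.reverse :=
  rfl

/-- **(T0) for the boundary age**: it never exceeds the boundary length. [folklore] -/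
theorem boundaryKey_le_length (hW : IsLocallyNoetherian W) (N : ℕ) (ν : ℕ → ℕ) (L : Labelling W) (P : Option (Pending W)) (E : Boundary W)
    (x : W) : boundaryKey W hW N ν L P E x ≤ E.length := by
  rw [boundaryKey_eq, ← List.length_reverse]
  exact lastKeyRev_le_length x _

/-- **(T3) for the boundary age**: a point of `blowup C` ON the exceptional divisor has age `|E| + 1` for the updated boundary `E.next C` (the new member
is the youngest one through it). [folklore] -/
theorem boundaryKey_next_of_mem (E : Boundary W) (C : W.IdealSheafData) (h : IsLocallyNoetherian (blowup C))
    (N : ℕ) (ν : ℕ → ℕ) (L' : Labelling (blowup C)) (P' : Option (Pending (blowup C))) {y' : ↥(blowup C)}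
    (hy' : (blowup.π C).base y' ∈ (C.support : Set W)) :
    boundaryKey (blowup C) h N ν L' P' (E.next C) y' = E.length + 1 := by
  have hmem : y' ∈ ((C.comap (blowup.π C)).support : Set ↥(blowup C)) := by
    rw [coe_support_comap_blowup]; exact hy'
  rw [boundaryKey_eq, Boundary.next, List.reverse_append]
  simp [lastKeyRev_cons_of_mem hmem]

/-- Off the centre, a point of the blow-up lies on the strict transform of `V(K)` iff it lies over `V(K)` (there the strict transform is the total
transform). [cite: GortzWedhorn2020, (13.19) p. 414] -/
theorem mem_support_strictTransformIdeal_iff_of_not_mem [IsLocallyNoetherian W] (C K : W.IdealSheafData) [IsLocallyNoetherian (blowup C)]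
    {y' : ↥(blowup C)} (hy' : (blowup.π C).base y' ∉ (C.support : Set W)) :
    y' ∈ ((strictTransformIdeal (blowup.π C) C K).support : Set ↥(blowup C)) ↔ (blowup.π C).base y' ∈ (K.support : Set W) := by
  have h1 : y' ∈ ((strictTransformIdeal (blowup.π C) C K).support : Set ↥(blowup C)) ↔
      y' ∈ ((K.comap (blowup.π C)).support : Set ↥(blowup C)) := by
    simp only [SetLike.mem_coe]
    rw [mem_support_iff_stalkIdeal_le, mem_support_iff_stalkIdeal_le, (blowup.isBlowup C).stalkIdeal_strictTransformIdeal_of_not_mem K hy']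
  rw [h1, SetLike.mem_coe, Scheme.IdealSheafData.support_comap]
  rfl

/-- **The age half of (T2) for the boundary age**: a point of `blowup C` OFF the exceptional divisor has, for `E.next C`, the age of its image for `E`
(the members through it are the strict transforms of the members through its image, in the same order). [folklore] -/
theorem boundaryKey_next_of_not_mem [IsLocallyNoetherian W] (hW : IsLocallyNoetherian W) (E : Boundary W) (C : W.IdealSheafData)
    (h : IsLocallyNoetherian (blowup C)) (N N' : ℕ) (ν ν' : ℕ → ℕ) (L : Labelling W) (L' : Labelling (blowup C)) (P : Option (Pending W))
    (P' : Option (Pending (blowup C))) {y' : ↥(blowup C)} (hy' : (blowup.π C).base y' ∉ (C.support : Set W)) :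
    boundaryKey (blowup C) h N' ν' L' P' (E.next C) y' = boundaryKey W hW N ν L P E ((blowup.π C).base y') := by
  haveI := h
  have hnot : y' ∉ ((C.comap (blowup.π C)).support : Set ↥(blowup C)) := by
    rw [coe_support_comap_blowup]; exact hy'
  have hrev : (E.map (strictTransformIdeal (blowup.π C) C)).reverse = E.reverse.map (strictTransformIdeal (blowup.π C) C) := by
    simp
  rw [boundaryKey_eq, boundaryKey_eq, Boundary.next, List.reverse_append]
  simp only [List.reverse_cons, List.reverse_nil, List.nil_append, List.singleton_append, lastKeyRev_cons_of_not_mem hnot, hrev]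
  exact lastKeyRev_map _ _ fun I _ => mem_support_strictTransformIdeal_iff_of_not_mem C I hy'

/-- **Off the centre, the old members through `x'` ARE the members through its image** (equality in 067's `oldThrough_sublist`). [folklore] -/
theorem oldThrough_eq_membersThrough_of_not_mem [IsLocallyNoetherian W] (E : Boundary W) (C : W.IdealSheafData) [IsLocallyNoetherian (blowup C)]
    {x' : ↥(blowup C)} (hx' : (blowup.π C).base x' ∉ (C.support : Set W)) :
    oldThrough E C x' = membersThrough E ((blowup.π C).base x') := by
  classical
  rw [oldThrough, membersThrough]
  exact List.filter_congr fun I _ => by rw [decide_eq_decide]; exact mem_support_strictTransformIdeal_iff_of_not_mem C I hx'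

/-- **The corner half of (T2): OFF the exceptional divisor the boundary-corner size is UNCHANGED** (`=` in 067's `cornerSize_next_of_not_mem`).
[folklore] -/
theorem cornerSize_next_eq_of_not_mem [IsLocallyNoetherian W] (E : Boundary W) (C : W.IdealSheafData) [IsLocallyNoetherian (blowup C)]
    {x' : ↥(blowup C)} (hx' : (blowup.π C).base x' ∉ (C.support : Set W)) :
    cornerSize (E.next C) x' = cornerSize E ((blowup.π C).base x') := by
  classical
  have hx'F : x' ∉ ((C.comap (blowup.π C)).support : Set ↥(blowup C)) := by
    rw [coe_support_comap_blowup]; exact hx'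
  rw [cornerSize_next, if_neg hx'F, add_zero, oldThrough_eq_membersThrough_of_not_mem E C hx', cornerSize]

/-- … so OFF the exceptional divisor a point is a full corner iff its image is. [folklore] -/
theorem isFullCorner_next_iff_of_not_mem [IsLocallyNoetherian W] (E : Boundary W) (C : W.IdealSheafData) [IsLocallyNoetherian (blowup C)]
    {x' : ↥(blowup C)} (hx' : (blowup.π C).base x' ∉ (C.support : Set W)) :
    IsFullCorner (E.next C) x' ↔ IsFullCorner E ((blowup.π C).base x') := by
  rw [isFullCorner_iff_three_le, isFullCorner_iff_three_le, cornerSize_next_eq_of_not_mem E C hx']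

/-- **(T1) supplier for isolated points**: the points `x` with `{x}` an irreducible component of `Y` are finitely many on a noetherian stage (they
embed into `componentsIn Y`, finite by `componentsIn.finite`); with 067's `InScopeMσE.fullCornerLocus_finite` for corners. [folklore] -/
theorem setOf_singleton_mem_componentsIn_finite [NoetherianSpace W] (Y : Set W) : {x : W | ({x} : Set W) ∈ componentsIn Y}.Finite :=
  (componentsIn.finite Y).preimage (Set.injOn_of_injective Set.singleton_injective)

end Key

/-! ## §5. The boundary age under a GENERIC boundary update `E.map f ++ [F]` (transform-parametric twins of §4, appended 2026-08-27 g9)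

The σ-layer's boundary update `Boundary.next E C = E.map (strictTransformIdeal (blowup.π C) C) ++ [C.comap (blowup.π C)]` is ONE instance of the shape
«member-wise transform, then append the new exceptional member»; Cossart–Jannsen–Saito's COMPLETE TRANSFORM (LNM 2270 Def. 5.7: principal strict
transforms + `E`) is another. The age laws (T3)/(T2-age) only use two support facts about the member transform `f` and the new member `F` — so they are
stated here once for every such update (res-type-067's (IC) audit 2026-08-27T15:05Z / this typer's OWNER'S POSITION: transform-parametric bookkeeping). -/

section KeyGeneric

variable {W W' : Scheme.{u}}

/-- **(T3), generic**: under the update `E.map f ++ [F]`, a point ON the new member `F` has age `|E| + 1`. [folklore] -/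
theorem boundaryKey_mapAppend_of_mem (hW : IsLocallyNoetherian W') (E : Boundary W) (f : W.IdealSheafData → W'.IdealSheafData)
    (F : W'.IdealSheafData) (N : ℕ) (ν : ℕ → ℕ) (L' : Labelling W') (P' : Option (Pending W')) {y' : W'} (hy' : y' ∈ (F.support : Set W')) :
    boundaryKey W' hW N ν L' P' (E.map f ++ [F]) y' = E.length + 1 := by
  rw [boundaryKey_eq, List.reverse_append]
  simp [lastKeyRev_cons_of_mem hy']

/-- **(T2-age), generic**: under the update `E.map f ++ [F]`, a point `y'` OFF the new member whose membership in the transformed members mirrors the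
membership of a point `x` in the members (`y' ∈ V(f I) ↔ x ∈ V(I)`, e.g. `x = π y'` off the centre for the saturated OR the principal strict
transform) has the age of `x`. [folklore] -/
theorem boundaryKey_mapAppend_of_not_mem (hW : IsLocallyNoetherian W) (hW' : IsLocallyNoetherian W') (E : Boundary W)
    (f : W.IdealSheafData → W'.IdealSheafData) (F : W'.IdealSheafData) (N N' : ℕ) (ν ν' : ℕ → ℕ) (L : Labelling W) (L' : Labelling W')
    (P : Option (Pending W)) (P' : Option (Pending W')) {y' : W'} {x : W} (hy' : y' ∉ (F.support : Set W'))
    (hf : ∀ I ∈ E, (y' ∈ ((f I).support : Set W') ↔ x ∈ (I.support : Set W))) :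
    boundaryKey W' hW' N' ν' L' P' (E.map f ++ [F]) y' = boundaryKey W hW N ν L P E x := by
  have hrev : (E.map f).reverse = E.reverse.map f := by simp
  rw [boundaryKey_eq, boundaryKey_eq, List.reverse_append]
  simp only [List.reverse_cons, List.reverse_nil, List.nil_append, List.singleton_append, lastKeyRev_cons_of_not_mem hy', hrev]
  exact lastKeyRev_map _ _ fun I hI => hf I (List.mem_reverse.mp hI)

/-- The σ-layer's update is an instance: `E.next C = E.map (strictTransformIdeal (blowup.π C) C) ++ [C.comap (blowup.π C)]` (`rfl`). [folklore] -/
theorem Boundary.next_eq_mapAppend {W : Scheme.{u}} (E : Boundary W) (C : W.IdealSheafData) :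
    E.next C = E.map (strictTransformIdeal (blowup.π C) C) ++ [C.comap (blowup.π C)] :=
  rfl

end KeyGeneric

end Summit.ResolutionOfSingularities.ResolutionOfSingularities.Theorems.SigmaMaxModificationsCorridor3.Sigma

end
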